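import Summits.ValiantsHypothesis.ValiantsHypothesis.Theorems.KPlusLogSqLawTropicalBTwoBoundaryPortExact
import Summits.ValiantsHypothesis.ValiantsHypothesis.Theorems.KPlusLogSqLawTropicalBFerrersRank

/-!
# Route «KPlusLogSqLaw», crux `TropicalB` (stmt-ValiantsHypothesis-19771) — NESTED boundary pairs are quadratic by counting:
# the content of `BoundaryVertexLaw 2 2` lies in CROSSING pairs

HONEST FRAMING.  Proof file (pure corollaries), seat val-sym-trop-p1 g17 (cell `pub-symmetroid`, 2026-08-28), `--supports stmt-ValiantsHypothesis-19771
--as helper`, toward the registered stubs `stub_tropThin` / `stub_tropFat` of `Cruxes/TropicalB/Lines/birth.lean` (crux `TropicalB`).  A slope-COUNTING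
remark complementing this seat's `TwoPort.not_boundaryVertexLaw_two_one` (two boundaries are at least quadratic) and `TwoPort.halfSwap_exactlyQuadratic`
(the port's pair is exactly quadratic): if the two boundaries are NESTED (`π 1 a < ρ 1 b → π 0 a < ρ 0 b`, i.e. the second biorder lies inside the first),
the pattern `(0,1)` never occurs, the exponent matrix is `d(lab 00) + (d(lab 10) − d(lab 00))·[π 0 a < ρ 0 b] + (d(lab 11) − d(lab 10))·[π 1 a < ρ 1 b]`
— a LINEAR labelling of two biorders — and val-sym-trop-p1 g15's Ferrers-rank law gives at most `(m+1)²` dominant terms for EVERY labelling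
(`card_dominant_le_sq_of_nested`).  So `BoundaryVertexLaw 2 2` holds by counting on nested pairs and on the half-swap pair; its content is the
CROSSING pairs (neither biorder inside the other, `(0,1)`- and `(1,0)`-counts untied), e.g. identity × row-reversal.  Nothing here is beyond counting;
nothing bears on `TropicalB` in its window, `WeakLifting`, DoorA26 / DoorA34, `MatrixDescartes` (stmt-ValiantsHypothesis-18050) or VP ≠ VNP.
-/

set_option linter.dupNamespace false
set_option autoImplicit false

namespace Summit.ValiantsHypothesis.ValiantsHypothesis.Theorems.KPlusLogSqLaw

namespace BoundarySector

open Summit.ValiantsHypothesis.ValiantsHypothesis.Theorems.MatrixDescartes.Negative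
open Summit.ValiantsHypothesis.ValiantsHypothesis.Theorems.LacunarySymmetroidMatrixDescartes
open Finset

variable {m K : ℕ}

/-- in a nested pair the pattern of a cell is determined by its two bits through three cases. -/
theorem lab_pattern_eq_of_nested (π ρ : Fin 2 → Equiv.Perm (Fin m)) (hnest : ∀ a b, π 1 a < ρ 1 b → π 0 a < ρ 0 b)
    (lab : (Fin 2 → Bool) → Fin K) (d : Fin K → ℕ) (a b : Fin m) :
    (d (lab (pattern π ρ a b)) : ℤ) = (d (lab ![false, false]) : ℤ) +
      ((d (lab ![true, false]) : ℤ) - d (lab ![false, false])) * (if π 0 a < ρ 0 b then 1 else 0) +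
      ((d (lab ![true, true]) : ℤ) - d (lab ![true, false])) * (if π 1 a < ρ 1 b then 1 else 0) := by
  have hp : pattern π ρ a b = ![decide (π 0 a < ρ 0 b), decide (π 1 a < ρ 1 b)] := by
    funext j; fin_cases j <;> rfl
  by_cases h0 : π 0 a < ρ 0 b
  · by_cases h1 : π 1 a < ρ 1 b
    · rw [hp, decide_eq_true h0, decide_eq_true h1, if_pos h0, if_pos h1]; ring
    · rw [hp, decide_eq_true h0, decide_eq_false h1, if_pos h0, if_neg h1]; ring
  · have h1 : ¬ π 1 a < ρ 1 b := fun h1 => h0 (hnest a b h1)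
    rw [hp, decide_eq_false h0, decide_eq_false h1, if_neg h0, if_neg h1]; ring

/-- **Nested boundary pairs are quadratic (by counting).**  For a dense boundary-type design on a NESTED pair of boundaries, every unsigned
dominant chain has `n + 1 ≤ (m+1)²`, for every labelling, exponents and valuations. -/
theorem designRowD_of_nested (π ρ : Fin 2 → Equiv.Perm (Fin m)) (hnest : ∀ a b, π 1 a < ρ 1 b → π 0 a < ρ 0 b)
    (lab : (Fin 2 → Bool) → Fin K) (d : Fin K → ℕ) (v ε : Fin m → Fin m → Fin K → ℤ) (hε : IsBoundaryDesign π ρ lab ε) :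
    DesignRowD d v ε ((m + 1) ^ 2 - 1) := by
  refine designRowD_of_ferrers d v ε (r := 2) (fun j a => ((π j a : ℕ) : ℤ)) (fun j b => ((ρ j b : ℕ) : ℤ))
    ![(d (lab ![true, false]) : ℤ) - d (lab ![false, false]), (d (lab ![true, true]) : ℤ) - d (lab ![true, false])]
    (fun _ => (d (lab ![false, false]) : ℤ)) (fun _ => 0) ?_
  intro a b l hl
  rw [(hε a b l).1 hl, lab_pattern_eq_of_nested π ρ hnest lab d a b]
  simp only [Fin.sum_univ_two, Matrix.cons_val_zero, Matrix.cons_val_one, Nat.cast_lt, Fin.val_fin_lt, add_zero]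
  ring

open scoped Classical in
/-- **At most `(m+1)²` dominant terms on a nested boundary pair** (so `BoundaryVertexLaw 2 2` holds by counting there; its content is the crossing
pairs). -/
theorem card_dominant_le_sq_of_nested (π ρ : Fin 2 → Equiv.Perm (Fin m)) (hnest : ∀ a b, π 1 a < ρ 1 b → π 0 a < ρ 0 b)
    (lab : (Fin 2 → Bool) → Fin K) (d : Fin K → ℕ) (v ε : Fin m → Fin m → Fin K → ℤ) (hε : IsBoundaryDesign π ρ lab ε) :
    (univ.filter fun q : Equiv.Perm (Fin m) × (Fin m → Fin K) => ∃ t : ℤ, IsDominant d v ε t q).card ≤ (m + 1) ^ 2 := by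
  have h := card_dominant_le_succ d v ε (designRowD_of_nested π ρ hnest lab d v ε hε)
  have hpos : 1 ≤ (m + 1) ^ 2 := Nat.one_le_pow _ _ (Nat.succ_pos m)
  omega

end BoundarySector

end Summit.ValiantsHypothesis.ValiantsHypothesis.Theorems.KPlusLogSqLaw
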